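import Summits.HodgeConjecture.HodgeConjecture.Theorems.NikulinTwinTransportSquareGlueFreeEndomorphisms
import Summits.HodgeConjecture.HodgeConjecture.Theorems.NoetherLefschetzOneUpK3TypeNetsPgZeroFactor
import Summits.HodgeConjecture.HodgeConjecture.Theses.NikulinTwinTransport
import Literature.AlgebraicGeometry.HodgeTheory.HardLefschetzNFoldHolds
import Literature.AlgebraicGeometry.HodgeTheory.AbelJacobiPullbackHodgeSection

/-!
# Route NikulinTwinTransport · `SquareGlue` (stmt-HodgeConjecture-13682) — PROVED, unconditionally

Third file of the marking-free, `b₁`-free bookkeeping. The glue item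
`SquareGlue := RealMultiplicationSqrtTwoAlgebraic → LefschetzOneOneK3 → SquareHodgeOfSqrtTwo` of route
NikulinTwinTransport (Varesco 2023, p. 8: "proving the Hodge conjecture for `X²` is equivalent to showing
that every element of `End_Hdg(T(X))` is algebraic") was landed conditionally (`squareGlue_of_facts`,
p92476) on the named facts `Huybrechts_K3_marking_exists` and `Huybrechts_K3_oddBetti_vanish`. Here it is
proved with NO named-fact hypothesis, by an argument that needs neither a marking nor `b₁(S) = 0`:

* `mem_supportedClasses_one_of_corrFst_eq_zero` — **a class `w ∈ H⁴((S ⊗ S)(ℂ))` acting trivially on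
  `H²(S)` is supported on a divisor**: by Künneth (`kunnethSpan_complexBetti`, PROVED) `w = w₀ + w₂₂` with
  `w₀` a combination of cross products `pr₁^* b ∪ pr₂^* w'` having a factor of degree `≥ 3` — supported on
  a divisor (`mem_supportedClasses_one_of_dim_lt`, pull-back along a surjective projection, cup product)
  and acting by zero on `H²` (degree) — and `w₂₂ = Σ_α pr₁^* v_α ∪ pr₂^* B_α` over a basis `(v_α)` of
  `H²(S)`, acting by `y ↦ κ Σ_α (∫ y ∪ B_α) v_α` (`corrFst_cross_of_cup_eq`); so `∫ y ∪ B_α = 0` for all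
  `y`, `B_α = 0` by Poincaré duality, `w₂₂ = 0`. NO HYPOTHESIS `H¹(S) = 0`: the `H¹ ⊗ H³` and `H³ ⊗ H¹`
  Künneth components are divisor-supported like everything else in `w₀`.
* `mem_algebraicClasses_two_of_sector_free` — **rational `(2,2)`-classes on `S × S` are algebraic on the
  sector**: `z - Γ` acts trivially on `H²` for the algebraic `Γ` of bookkeeping II
  (`exists_algebraicClass_of_corrFst`), hence lies in `N¹H⁴`; so does `Γ ∈ N² ⊆ N¹`; and a RATIONAL
  `(2,2)`-class of a smooth projective fourfold supported on a divisor is algebraic — the CLOSED route item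
  `NodalSupport.DivisorInduction` (Deligne, Hodge III 8.2.8) with Lefschetz `(1,1)`, as assembled in
  `PgOneProductClasses.mem_algebraicClasses_two_of_mem_supportedClasses_one`.
* `squareGlue_proof : Theses.NikulinTwinTransport.SquareGlue` — the item: codimension `2` by the above
  with `μ = complexOrientationFamily`, the other codimensions by Lefschetz `(1,1)` and hard Lefschetz
  (`hodgeClasses_algebraic_fourfold_of_hodgeTwoTwo`), Hodge models by `nonempty_hodgeModel_holds`. The
  K3 hypotheses of the sector (`H¹(𝒪_S) = 0`, the holomorphic `2`-form), `he_typ`, `he_adj` and the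
  antecedent `LefschetzOneOneK3` are not used beyond being passed to `RealMultiplicationSqrtTwoAlgebraic`
  (Lefschetz `(1,1)` holds for every smooth projective variety, `lefschetzOneOne_rational_holds`).

No definition, no named-fact hypothesis, no sorry. Prover seat ring2-b02 (gen 47).

References: Varesco, *Hodge similitudes and the Hodge conjecture for squares of K3 surfaces* (2023), §2
p. 8; Voisin, *Hodge Theory and Complex Algebraic Geometry I*, Thm. 11.30, Lemma 11.41, Thm. 6.25;
Hatcher, *Algebraic Topology*, Thm. 3.16, Prop. 3.38; Deligne, Hodge III, Cor. 8.2.8.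
-/

set_option linter.dupNamespace false

noncomputable section

namespace Summit.HodgeConjecture.HodgeConjecture.Theorems.NikulinTwinTransport.SquareGlueFree

open scoped Manifold
open CategoryTheory MonoidalCategory CartesianMonoidalCategory
open Literature.AlgebraicGeometry Literature.AlgebraicGeometry.Motives Literature.AlgebraicGeometry.HodgeTheory
open Literature.AlgebraicTopology.SingularHomology

variable {S : SchemeOver ℂ}

/-- `Corr[μ, hS ; γ, y] = pr₁_*(pr₂^* y ∪ γ)` on `H²(S(ℂ); ℂ)`. Local notation only. -/
local notation3 (prettyPrint := false) "Corr[" μ ", " hS " ; " γ ", " y "]" =>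
  complexGysin μ (IsSmoothProjective.tensor_holds hS hS) hS
    (SemiCartesianMonoidalCategory.fst _ _) (rfl : 2 * 1 + 2 * 2 + 2 * 2 = 2 * 1 + 2 * (2 + 2))
    (cupProduct (rfl : 2 * 1 + 2 * 2 = 2 * 1 + 2 * 2)
      (complexBetti.map (SemiCartesianMonoidalCategory.snd _ _) (2 * 1) y) γ)

/-! ### A class acting trivially on `H²` is supported on a divisor -/

/-- **A class of `H⁴((S ⊗ S)(ℂ); ℂ)` whose action `y ↦ pr₁_*(pr₂^* y ∪ w)` on `H²(S(ℂ); ℂ)` vanishes is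
supported on a divisor** (`w ∈ N¹H⁴`), for every smooth projective surface `S` and orientation family
`μ` — with NO hypothesis on `H¹(S)`. Künneth (`kunnethSpan_complexBetti`) splits `w = w₀ + w₂₂`: the
cross products with a factor of degree `≥ 3` are divisor-supported (`mem_supportedClasses_one_of_dim_lt`,
`map_mem_supportedClasses_one_of_surjective`, cup products) and act by zero on `H²`
(`corrFst_cross_eq_zero_of_lt/gt`); the `H² ⊗ H²`-part `Σ_α pr₁^* v_α ∪ pr₂^* B_α` (`v_α` a basis of
`H²(S)`) acts by `y ↦ κ Σ_α (∫_S y ∪ B_α) v_α`, `κ ≠ 0` (`corrFst_cross_of_cup_eq`, fibre integration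
`exists_fibreIntegral_fst`), so all `∫_S y ∪ B_α` vanish and `B_α = 0` by Poincaré duality
(`eq_zero_of_forall_cupPairing_eq_zero`). [cite: HatcherAT2002, §3.2 Thm. 3.16 and §3.3 Prop. 3.38]
[cite: VoisinHodgeI2002, §11.3.3 Lemma 11.41] -/
theorem mem_supportedClasses_one_of_corrFst_eq_zero (μ : OrientationFamily) (hS : IsSmoothProjective 2 S)
    {w : complexBetti (S ⊗ S) (2 * 2)} (hw : ∀ y : complexBetti S (2 * 1), Corr[μ, hS ; w, y] = 0) :
    w ∈ supportedClasses (S ⊗ S) (2 * 2) 1 := by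
  classical
  have h4 : 2 * 1 + 2 * 1 = 2 * 2 := rfl
  have hSS : IsSmoothProjective (2 + 2) (S ⊗ S) := IsSmoothProjective.tensor_holds hS hS
  obtain ⟨y₀⟩ := nonempty_complexPoints hS
  have hfst : Function.Surjective (fst S S).left.base := surjective_fst_left_base y₀
  have hsnd : Function.Surjective (snd S S).left.base := PgOneProductClasses.surjective_snd_left_base y₀
  -- the two spans: cross products with a factor of degree `≠ 2`, and `H² ⊗ H²`
  set V₀ : Submodule ℂ (complexBetti (S ⊗ S) (2 * 2)) := Submodule.span ℂ
    {v | ∃ (i j : ℕ) (h : i + j = 2 * 2) (b : complexBetti S i) (w' : complexBetti S j), j ≠ 2 ∧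
      v = cupProduct h (complexBetti.map (fst S S) i b) (complexBetti.map (snd S S) j w')} with hV₀
  set V₂ : Submodule ℂ (complexBetti (S ⊗ S) (2 * 2)) := Submodule.span ℂ
    {v | ∃ (a b : complexBetti S (2 * 1)),
      v = cupProduct h4 (complexBetti.map (fst S S) (2 * 1) a) (complexBetti.map (snd S S) (2 * 1) b)}
    with hV₂
  have hwsup : w ∈ V₀ ⊔ V₂ := by
    refine (Submodule.span_le.2 ?_) (kunnethSpan_complexBetti hS hS (2 * 2) w)
    rintro v ⟨i, j, hij, b, w', rfl⟩
    by_cases hj : j = 2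
    · obtain rfl : j = 2 * 1 := by omega
      obtain rfl : i = 2 * 1 := by omega
      exact Submodule.mem_sup_right (Submodule.subset_span ⟨b, w', rfl⟩)
    · exact Submodule.mem_sup_left (Submodule.subset_span ⟨i, j, hij, b, w', hj, rfl⟩)
  obtain ⟨w₀, hw₀, w₂, hw₂, rfl⟩ := Submodule.mem_sup.1 hwsup
  -- `V₀` is supported on a divisor
  have hV₀N : V₀ ≤ supportedClasses (S ⊗ S) (2 * 2) 1 := by
    refine Submodule.span_le.2 ?_
    rintro v ⟨i, j, hij, b, w', hj, rfl⟩
    by_cases hj3 : 3 ≤ j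
    · have hw' : w' ∈ supportedClasses S j 1 := mem_supportedClasses_one_of_dim_lt hS (by omega) w'
      exact cupProduct_mem_supportedClasses_right hij _
        (map_mem_supportedClasses_one_of_surjective hSS hS (snd S S) hsnd hw')
    · have hb : b ∈ supportedClasses S i 1 := mem_supportedClasses_one_of_dim_lt hS (by omega) b
      exact PullbackAlgebraicNormalCone.CupDivisor.cupProduct_mem_supportedClasses_left hij
        (map_mem_supportedClasses_one_of_surjective hSS hS (fst S S) hfst hb) _
  -- `V₀` acts by zero on `H²`
  have hV₀act : ∀ v ∈ V₀, ∀ y : complexBetti S (2 * 1), Corr[μ, hS ; v, y] = 0 := by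
    intro v hv y
    induction hv using Submodule.span_induction with
    | mem v hv =>
      obtain ⟨i, j, hij, b, w', hj, rfl⟩ := hv
      by_cases hj3 : 3 ≤ j
      · exact corrFst_cross_eq_zero_of_gt μ hS hS hij (rfl : 2 * 1 + 2 * 2 = 2 * 1 + 2 * 2)
          (rfl : 2 * 1 + 2 * 2 + 2 * 2 = 2 * 1 + 2 * (2 + 2)) (by omega) y b w'
      · exact corrFst_cross_eq_zero_of_lt μ hS hS hij (rfl : 2 * 1 + 2 * 2 = 2 * 1 + 2 * 2)
          (rfl : 2 * 1 + 2 * 2 + 2 * 2 = 2 * 1 + 2 * (2 + 2)) (by omega) y b w'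
    | zero => rw [map_zero, map_zero]
    | add v v' _ _ hv hv' => rw [map_add, map_add, hv, hv', add_zero]
    | smul t v _ hv => rw [map_smul, map_smul, hv, smul_zero]
  -- hence `w₂` acts by zero on `H²`
  have hw₂act : ∀ y : complexBetti S (2 * 1), Corr[μ, hS ; w₂, y] = 0 := fun y ↦ by
    have h := hw y
    rwa [map_add, map_add, hV₀act w₀ hw₀ y, zero_add] at h
  -- normal form of `w₂` over a basis `v` of `H²(S)`
  obtain ⟨ρ, v, -⟩ := exists_basis_isRationalClass hS (2 * 1)
  have hnf : ∀ x ∈ V₂, ∃ B : Fin ρ → complexBetti S (2 * 1),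
      x = ∑ α, cupProduct h4 (complexBetti.map (fst S S) (2 * 1) (v α))
        (complexBetti.map (snd S S) (2 * 1) (B α)) := by
    intro x hx
    induction hx using Submodule.span_induction with
    | mem x hx =>
      obtain ⟨a, b, rfl⟩ := hx
      refine ⟨fun α ↦ (v.repr a α) • b, ?_⟩
      conv_lhs => rw [← v.sum_repr a]
      rw [map_sum, map_sum, LinearMap.sum_apply]
      refine Finset.sum_congr rfl fun α _ ↦ ?_
      rw [map_smul, map_smul, LinearMap.smul_apply, map_smul, map_smul]
    | zero => exact ⟨0, by simp⟩
    | add x x' _ _ hx hx' =>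
      obtain ⟨B, rfl⟩ := hx
      obtain ⟨B', rfl⟩ := hx'
      exact ⟨B + B', by simp [Finset.sum_add_distrib, map_add]⟩
    | smul t x _ hx =>
      obtain ⟨B, rfl⟩ := hx
      exact ⟨t • B, by simp [Finset.smul_sum, map_smul]⟩
  obtain ⟨B, hB⟩ := hnf w₂ hw₂
  -- fibre integration
  obtain ⟨ω, hω⟩ := exists_traceC_eq_one hS
  have hω0 : ω ≠ 0 := by
    rintro rfl
    rw [map_zero] at hω
    exact zero_ne_one hω
  obtain ⟨κ, hκ0, hκ⟩ := exists_fibreIntegral_fst μ hS hS (kunnethSpan_complexBetti hS hS (2 * (2 + 2)))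
    hω0 (rfl : 2 * 2 + 2 * 2 = 0 + 2 * (2 + 2))
  -- the action of `w₂`: `y ↦ Σ_α (κ ∫ y ∪ B_α) • v_α`
  have hact : ∀ y : complexBetti S (2 * 1),
      Corr[μ, hS ; w₂, y] = ∑ α, (traceC hS (cupProduct h4 y (B α)) * κ) • v α := by
    intro y
    rw [hB, map_sum, map_sum]
    refine Finset.sum_congr rfl fun α _ ↦ ?_
    rw [corrFst_cross_of_cup_eq μ hS hS h4 (rfl : 2 * 1 + 2 * 2 = 2 * 1 + 2 * 2) h4
      (rfl : 2 * 1 + 2 * 2 + 2 * 2 = 2 * 1 + 2 * (2 + 2)) (rfl : 2 * 2 + 2 * 2 = 0 + 2 * (2 + 2)) hκ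
      (v α) (eq_traceC_smul hS hω (cupProduct h4 y (B α)))]
    congr 1
    rw [show ((-1 : ℂ) ^ (2 * 1 * (2 * 1))) = 1 by norm_num, one_mul]
  -- all `B_α` vanish
  have hB0 : ∀ α, B α = 0 := by
    intro α
    have hyB : ∀ y : complexBetti S (2 * 1), cupProduct h4 y (B α) = 0 := by
      intro y
      have h0 := hw₂act y
      rw [hact y] at h0
      have hcoef := Fintype.linearIndependent_iff.1 v.linearIndependent
        (fun α ↦ traceC hS (cupProduct h4 y (B α)) * κ) h0 α
      have htr : traceC hS (cupProduct h4 y (B α)) = 0 := (mul_eq_zero.1 hcoef).resolve_right hκ0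
      exact eq_zero_of_traceC_eq_zero hS htr
    refine eq_zero_of_forall_cupPairing_eq_zero μ hS h4 fun y ↦ ?_
    rw [cupPairing_apply, cupProduct_gradedComm_holds ℂ _ h4 h4, hyB y, smul_zero, map_zero,
      LinearMap.zero_apply]
  have hw₂0 : w₂ = 0 := by
    rw [hB]
    exact Finset.sum_eq_zero fun α _ ↦ by rw [hB0 α, map_zero, map_zero]
  rw [hw₂0, add_zero]
  exact hV₀N hw₀

/-! ### Rational `(2,2)`-classes on `S × S` are algebraic on the sector -/

/-- **On the sector of route NikulinTwinTransport, every rational `(2,2)`-class on `S × S` is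
algebraic** — for EVERY smooth projective surface `S` and orientation family `μ`, given a rational
endomorphism `e` of `H²(S(ℂ); ℂ)` killing `N¹H²` with algebraic class and the uniqueness clause `hU` of
`SquareHodgeOfSqrtTwo`. With the algebraic `Γ` of `exists_algebraicClass_of_corrFst`, `z - Γ` acts
trivially on `H²`, hence is supported on a divisor (`mem_supportedClasses_one_of_corrFst_eq_zero`); so is
`Γ ∈ N² ⊆ N¹`; and a rational `(2,2)`-class of a fourfold supported on a divisor is algebraic (closed item
`NodalSupport.DivisorInduction` + Lefschetz `(1,1)`,
`PgOneProductClasses.mem_algebraicClasses_two_of_mem_supportedClasses_one`). Marking-free and `b₁`-free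
replacement of `mem_algebraicClasses_two_of_sector`. [cite: Varesco2023, §2 (p. 8)]
[cite: DeligneHodgeIII1974, Cor. 8.2.8] [cite: VoisinHodgeI2002, Thm. 11.30] -/
theorem mem_algebraicClasses_two_of_sector_free (μ : OrientationFamily) (hS : IsSmoothProjective 2 S)
    (e : complexBetti S (2 * 1) →ₗ[ℂ] complexBetti S (2 * 1))
    (he_rat : ∀ y, IsRationalClass y → IsRationalClass (e y))
    (he_N : ∀ d ∈ algebraicClasses S 1, e d = 0)
    (hγe : ∃ γ ∈ algebraicClasses (S ⊗ S) 2, ∀ y : complexBetti S (2 * 1), e y = Corr[μ, hS ; γ, y])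
    (hU : ∀ (f : complexBetti S (2 * 1) →ₗ[ℂ] complexBetti S (2 * 1)),
      (∀ y, IsRationalClass y → IsRationalClass (f y)) →
      (∀ (i j : ℕ) y, IsOfHodgeType 2 S (2 * 1) i j y → IsOfHodgeType 2 S (2 * 1) i j (f y)) →
      (∀ d ∈ algebraicClasses S 1, f d = 0) →
      (∀ y : complexBetti S (2 * 1), ∀ d ∈ algebraicClasses S 1,
        cupProduct (rfl : 2 * 1 + 2 * 1 = 2 * 2) (f y) d = 0) →
      ∃ a b : ℚ, ∀ y : complexBetti S (2 * 1),
        (∀ d ∈ algebraicClasses S 1, cupProduct (rfl : 2 * 1 + 2 * 1 = 2 * 2) y d = 0) →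
        f y = (a : ℂ) • y + (b : ℂ) • e y)
    {z : complexBetti (S ⊗ S) (2 * 2)} (hzQ : IsRationalClass z)
    (hzT : IsOfHodgeType (2 + 2) (S ⊗ S) (2 * 2) 2 2 z) :
    z ∈ algebraicClasses (S ⊗ S) 2 := by
  have hX : IsSmoothProjective 4 (S ⊗ S) := IsSmoothProjective.tensor_holds hS hS
  obtain ⟨Γ, hΓalg, hΓ⟩ := exists_algebraicClass_of_corrFst μ hS e he_rat he_N hγe hU hzQ hzT
  -- `z - Γ` acts trivially on `H²`, hence is divisor-supported
  have hw : ∀ y : complexBetti S (2 * 1), Corr[μ, hS ; z - Γ, y] = 0 := fun y ↦ by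
    rw [map_sub, map_sub, hΓ y, sub_self]
  have hN : z - Γ ∈ supportedClasses (S ⊗ S) (2 * 2) 1 := mem_supportedClasses_one_of_corrFst_eq_zero μ hS hw
  have hΓN : Γ ∈ supportedClasses (S ⊗ S) (2 * 2) 1 := supportedClasses_mono (S ⊗ S) (2 * 2) one_le_two hΓalg
  have hz : z ∈ supportedClasses (S ⊗ S) (2 * 2) 1 := by
    have h := Submodule.add_mem _ hN hΓN
    rwa [sub_add_cancel] at h
  exact PgOneProductClasses.mem_algebraicClasses_two_of_mem_supportedClasses_one hX z hzQ hzT hz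

/-! ### The Hodge conjecture for `S × S` -/

/-- **The Hodge conjecture for `S ⊗ S` on the sector, for EVERY smooth projective surface `S`**: given a
rational endomorphism `e` of `H²(S(ℂ); ℂ)` killing `N¹H²` whose class is algebraic (for some orientation
family `μ`) and the uniqueness clause `hU` (rational Hodge endomorphisms killing `N` with image in
`T = N^⊥` are `a + b e` on `T`, `a, b ∈ ℚ`), `HodgeConjectureFor 4 (S ⊗ S)` holds: codimension `2` by
`mem_algebraicClasses_two_of_sector_free`, codimensions `0, 1, 3, 4` by Lefschetz `(1,1)` and hard
Lefschetz (`hodgeClasses_algebraic_fourfold_of_hodgeTwoTwo`, `lefschetzOneOne_rational_holds`,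
`nonempty_hardLefschetzNFold_holds`), Hodge models by `nonempty_hodgeModel_holds`.
[cite: Varesco2023, §2 (p. 8)] [cite: VoisinHodgeI2002, Thm. 11.30 and Thm. 6.25] -/
theorem hodgeConjectureFor_square_of_sector (μ : OrientationFamily) (hS : IsSmoothProjective 2 S)
    (e : complexBetti S (2 * 1) →ₗ[ℂ] complexBetti S (2 * 1))
    (he_rat : ∀ y, IsRationalClass y → IsRationalClass (e y))
    (he_N : ∀ d ∈ algebraicClasses S 1, e d = 0)
    (hγe : ∃ γ ∈ algebraicClasses (S ⊗ S) 2, ∀ y : complexBetti S (2 * 1), e y = Corr[μ, hS ; γ, y])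
    (hU : ∀ (f : complexBetti S (2 * 1) →ₗ[ℂ] complexBetti S (2 * 1)),
      (∀ y, IsRationalClass y → IsRationalClass (f y)) →
      (∀ (i j : ℕ) y, IsOfHodgeType 2 S (2 * 1) i j y → IsOfHodgeType 2 S (2 * 1) i j (f y)) →
      (∀ d ∈ algebraicClasses S 1, f d = 0) →
      (∀ y : complexBetti S (2 * 1), ∀ d ∈ algebraicClasses S 1,
        cupProduct (rfl : 2 * 1 + 2 * 1 = 2 * 2) (f y) d = 0) →
      ∃ a b : ℚ, ∀ y : complexBetti S (2 * 1),
        (∀ d ∈ algebraicClasses S 1, cupProduct (rfl : 2 * 1 + 2 * 1 = 2 * 2) y d = 0) →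
        f y = (a : ℂ) • y + (b : ℂ) • e y) :
    HodgeConjectureFor 4 (S ⊗ S) := by
  have hX : IsSmoothProjective 4 (S ⊗ S) := IsSmoothProjective.tensor_holds hS hS
  exact ⟨nonempty_hodgeModel_holds hX, fun p c hc hH ↦
    hodgeClasses_algebraic_fourfold_of_hodgeTwoTwo lefschetzOneOne_rational_holds
      (nonempty_hardLefschetzNFold_holds 4 (S ⊗ S)) hX
      (fun c' hc' hH' ↦ mem_algebraicClasses_two_of_sector_free μ hS e he_rat he_N hγe hU hc' hH') p c hc hH⟩

/-- **The Hodge conjecture for the self-product of a surface whose transcendental Hodge structure has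
only scalar endomorphisms.** For a smooth projective complex surface `S` such that every rational,
type-preserving endomorphism of `H²(S(ℂ); ℂ)` killing `N = N¹H²` with image cup-orthogonal to `N` acts on
`T = N^⊥` as a rational scalar (`End_Hdg(T(S)) = ℚ`, the case of a very general member of a family of
surfaces with `p_g > 0`), the Hodge conjecture holds
for `S ⊗ S` in every codimension — the case `e = 0` of `hodgeConjectureFor_square_of_sector` (the Hodge
classes of `S × S` are then spanned by the diagonal, products of divisors and the two fibre classes,
modulo `N¹`). [cite: Varesco2023, §2 (p. 8)] [cite: Huybrechts2019, §1 and Cor. 0.4]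
[cite: VoisinHodgeI2002, §11.3.3 Lemma 11.41] -/
theorem hodgeConjectureFor_square_of_hodgeEndomorphisms_scalar (hS : IsSmoothProjective 2 S)
    (hU₀ : ∀ (f : complexBetti S (2 * 1) →ₗ[ℂ] complexBetti S (2 * 1)),
      (∀ y, IsRationalClass y → IsRationalClass (f y)) →
      (∀ (i j : ℕ) y, IsOfHodgeType 2 S (2 * 1) i j y → IsOfHodgeType 2 S (2 * 1) i j (f y)) →
      (∀ d ∈ algebraicClasses S 1, f d = 0) →
      (∀ y : complexBetti S (2 * 1), ∀ d ∈ algebraicClasses S 1,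
        cupProduct (rfl : 2 * 1 + 2 * 1 = 2 * 2) (f y) d = 0) →
      ∃ a : ℚ, ∀ y : complexBetti S (2 * 1),
        (∀ d ∈ algebraicClasses S 1, cupProduct (rfl : 2 * 1 + 2 * 1 = 2 * 2) y d = 0) →
        f y = (a : ℂ) • y) :
    HodgeConjectureFor 4 (S ⊗ S) := by
  refine hodgeConjectureFor_square_of_sector complexOrientationFamily hS 0 (fun y _ ↦ ?_) (fun d _ ↦ rfl)
    ⟨0, Submodule.zero_mem _, fun y ↦ by rw [LinearMap.zero_apply, map_zero, map_zero]⟩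
    fun f hf₁ hf₂ hf₃ hf₄ ↦ ?_
  · rw [LinearMap.zero_apply]
    exact IsRationalClass.zero
  · obtain ⟨a, ha⟩ := hU₀ f hf₁ hf₂ hf₃ hf₄
    exact ⟨a, 0, fun y hy ↦ by rw [ha y hy, LinearMap.zero_apply, smul_zero, add_zero]⟩

/-! ### The glue item -/

/-- **`SquareGlue` (stmt-HodgeConjecture-13682), PROVED with no named-fact hypothesis**:
`RealMultiplicationSqrtTwoAlgebraic → LefschetzOneOneK3 → SquareHodgeOfSqrtTwo`. For a projective K3
surface `S` with real multiplication `e` by `√2` whose class is algebraic (the antecedent, instantiated at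
the complex orientation family) and `End_Hdg(T) ⊆ ℚ + ℚe` (the sector's uniqueness clause), the Hodge
conjecture holds for `S ⊗ S` (`hodgeConjectureFor_square_of_sector`). The Künneth bookkeeping "HC for `S²`
⟺ `End_Hdg(T(S))` algebraic" (Varesco 2023, p. 8) thus needs neither a marking of `H²(S, ℤ)` nor
`b₁(S) = 0`; the K3 clauses, `he_adj`, `he_T` and `LefschetzOneOneK3` are used only as inputs of the
antecedent. [cite: Varesco2023, §2 (p. 8)] [cite: VoisinHodgeI2002, Thm. 11.30 and Thm. 6.25]
[cite: DeligneHodgeIII1974, Cor. 8.2.8] -/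
theorem squareGlue_proof : Theses.NikulinTwinTransport.SquareGlue := by
  intro hRM _hL11 S hS e he_rat he_typ he_adj he_N he_T hU
  exact hodgeConjectureFor_square_of_sector complexOrientationFamily hS.1 e he_rat he_N
    (hRM complexOrientationFamily (OrientationFamily.hasPoincareDuality _) S hS e he_rat he_typ he_adj he_N he_T)
    hU

end Summit.HodgeConjecture.HodgeConjecture.Theorems.NikulinTwinTransport.SquareGlueFree

end
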